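import Literature.AlgebraicGeometry.Frobenioids.ModelFrobenioidSelfEquivalenceRigidityCocycle
import HarnessLib

/-!
# Frobenioids I, Thm. 5.2 (iv) / Prop. 5.6: twisted unit cocycles on a model Frobenioid — part 2
# (the coboundary identity along linear base-identity arrows and along pull-back morphisms)

Mochizuki, *The geometry of Frobenioids I: the general theory*, Kyushu J. Math. **62** (2008)
293–400, §5, Theorem 5.2 (i) p. 100, Theorem 5.2 (iv) pp. 101–103, Proposition 5.6 p. 105
[cite: MochizukiFrdI2008, Thm. 5.2 p.100]; [IUTchI] Remark 5.3.3 p. 146.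

PROOF-ONLY sequel of `ModelFrobenioidSelfEquivalenceRigidityCocycle.lean` (abc-iut, row «S2′», this file
abc-iut-L1-t7).  With `κ` a twisted unit cocycle on `C = ModelFrobenioid Φ B DivB` (`B` objectwise group-like)
satisfying (K1) and (K2) of the parent file and `ω_X` the units of `exists_omega` (characterised by
`ω_X · κ(s₀) = κ(F) · κ(s)` on every fraction presentation): the COBOUNDARY IDENTITY
`κ(φ) · Base(φ)^* ω_Y = u_φ · ω_X^{deg_Fr φ}` holds along linear base-identity arrows `(1, id, z, u)`
(`kappa_linear`, via (K2) on two parallel linear arrows out of `(A, 0)`) and along pull-back morphisms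
`(1, b, 0, 1)` (`kappa_pullback`, via (K1) on three squares of pull-backs); the Frobenius generator is
`kappa_frob` of the parent file and the assembly over all morphisms is `…Coboundary.lean`.
No statement of either paper is restated as a fact; nothing here bears on [IUTchIII] Cor. 3.12.
-/

namespace Literature.AlgebraicGeometry.Frobenioids

open CategoryTheory Opposite

universe w v u

namespace ModelFrobenioid

variable {D : Type u} [Category.{v} D] {Φ B : Dᵒᵖ ⥤ CommMonCat.{w}} {DivB : B ⟶ monoidGp Φ}
  (hB : ∀ (A : Dᵒᵖ) (b : B.obj A), IsUnit b)
  (κ : ∀ ⦃X Y : ModelFrobenioid Φ B DivB⦄, (X ⟶ Y) → B.obj (op X.base))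
  (hκc : ∀ ⦃X Y Z : ModelFrobenioid Φ B DivB⦄ (φ : X ⟶ Y) (ψ : Y ⟶ Z),
    κ (φ ≫ ψ) = pull B (baseMap φ) (κ ψ) * κ φ ^ (degFr ψ : ℕ))
  (hκr : ∀ ⦃X Y : ModelFrobenioid Φ B DivB⦄ (f g : X ⟶ Y), degFr f = 1 → degFr g = 1 →
    baseMap f = baseMap g → κ f * unit g = κ g * unit f)

section Generators

include hB hκc hκr

/-- **Coboundary identity along a linear base-identity arrow** `ℓ = (1, id, z, u) : X → X' = (A, δ)`:
`κ(ℓ) · ω_{X'} = u · ω_X`.  From (K1) on the square `s' ∘ ℓ` vs. `ℓ₂ ∘ s` into the common target and (K2) on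
the two parallel linear arrows out of `(A, 0)`. [cite: MochizukiFrdI2008, Thm. 5.2(iv) p.102] -/
theorem kappa_linear (X : ModelFrobenioid Φ B DivB) {δ : Algebra.GrothendieckGroup (Φ.obj (op X.base))}
    (ℓ : X ⟶ ⟨X.base, δ⟩) (hℓ1 : degFr ℓ = 1) (hℓb : baseMap ℓ = 𝟙 X.base) (ωX ωX' : B.obj (op X.base))
    (HX : ∀ ⦃δ₁ : Algebra.GrothendieckGroup (Φ.obj (op X.base))⦄
      (s : X ⟶ ⟨X.base, δ₁⟩) (s₀ : (⟨X.base, 1⟩ : ModelFrobenioid Φ B DivB) ⟶ ⟨X.base, δ₁⟩)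
      (F : (⟨X.base, 1⟩ : ModelFrobenioid Φ B DivB) ⟶ ⟨X.base, 1⟩),
      degFr s = 1 → baseMap s = 𝟙 X.base → unit s = 1 →
      degFr s₀ = 1 → baseMap s₀ = 𝟙 X.base → unit s₀ = 1 →
      degFr F = 2 → baseMap F = 𝟙 X.base → div F = 1 → unit F = 1 → ωX * κ s₀ = κ F * κ s)
    (HX' : ∀ ⦃δ₁ : Algebra.GrothendieckGroup (Φ.obj (op X.base))⦄
      (s : (⟨X.base, δ⟩ : ModelFrobenioid Φ B DivB) ⟶ ⟨X.base, δ₁⟩)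
      (s₀ : (⟨X.base, 1⟩ : ModelFrobenioid Φ B DivB) ⟶ ⟨X.base, δ₁⟩)
      (F : (⟨X.base, 1⟩ : ModelFrobenioid Φ B DivB) ⟶ ⟨X.base, 1⟩),
      degFr s = 1 → baseMap s = 𝟙 X.base → unit s = 1 →
      degFr s₀ = 1 → baseMap s₀ = 𝟙 X.base → unit s₀ = 1 →
      degFr F = 2 → baseMap F = 𝟙 X.base → div F = 1 → unit F = 1 → ωX' * κ s₀ = κ F * κ s) :
    κ ℓ * pull B (baseMap ℓ) ωX' = unit ℓ * ωX ^ (degFr ℓ : ℕ) := by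
  obtain ⟨x, y, hxy⟩ := exists_cls_eq_div X
  have hxy' : X.cls * Algebra.GrothendieckGroup.of y = Algebra.GrothendieckGroup.of x :=
    eq_div_iff_mul_eq'.mp hxy
  obtain ⟨x', y', hxy₁⟩ := exists_cls_eq_div (⟨X.base, δ⟩ : ModelFrobenioid Φ B DivB)
  have hxy₁' : δ * Algebra.GrothendieckGroup.of y' = Algebra.GrothendieckGroup.of x' :=
    eq_div_iff_mul_eq'.mp hxy₁
  -- the class equation of `ℓ`: `γ + z = δ + Div_B(u)`
  have hℓ : X.cls * Algebra.GrothendieckGroup.of (div ℓ) = δ * divB Φ B DivB (op X.base) (unit ℓ) := by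
    have h := rel ℓ
    rw [hℓ1, PNat.one_coe, pow_one, hℓb, pullGp_id] at h
    exact h
  -- presentations of `X` and `X'`, the common target `T = (A, δ + y' + y)`, the arrows into it
  let s : X ⟶ ⟨X.base, X.cls * Algebra.GrothendieckGroup.of y⟩ := mkHom _ _ 1 (𝟙 X.base) y 1
    (rel_step (B := B) (DivB := DivB) (γ := X.cls) (δ := X.cls * Algebra.GrothendieckGroup.of y) (w := y) rfl)
  let s₀ : (⟨X.base, 1⟩ : ModelFrobenioid Φ B DivB) ⟶ ⟨X.base, X.cls * Algebra.GrothendieckGroup.of y⟩ :=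
    mkHom _ _ 1 (𝟙 X.base) x 1
      (rel_step (B := B) (DivB := DivB) (γ := 1) (δ := X.cls * Algebra.GrothendieckGroup.of y) (w := x)
        (by rw [one_mul]; exact hxy'.symm))
  let s' : (⟨X.base, δ⟩ : ModelFrobenioid Φ B DivB) ⟶ ⟨X.base, δ * Algebra.GrothendieckGroup.of y'⟩ :=
    mkHom _ _ 1 (𝟙 X.base) y' 1
      (rel_step (B := B) (DivB := DivB) (γ := δ) (δ := δ * Algebra.GrothendieckGroup.of y') (w := y') rfl)
  let s₀' : (⟨X.base, 1⟩ : ModelFrobenioid Φ B DivB) ⟶ ⟨X.base, δ * Algebra.GrothendieckGroup.of y'⟩ :=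
    mkHom _ _ 1 (𝟙 X.base) x' 1
      (rel_step (B := B) (DivB := DivB) (γ := 1) (δ := δ * Algebra.GrothendieckGroup.of y') (w := x')
        (by rw [one_mul]; exact hxy₁'.symm))
  let F₂ : (⟨X.base, 1⟩ : ModelFrobenioid Φ B DivB) ⟶ ⟨X.base, 1⟩ :=
    mkHom _ _ 2 (𝟙 X.base) 1 1 (rel_frobZero X.base 2)
  let t : (⟨X.base, δ * Algebra.GrothendieckGroup.of y'⟩ : ModelFrobenioid Φ B DivB) ⟶
      ⟨X.base, δ * Algebra.GrothendieckGroup.of y' * Algebra.GrothendieckGroup.of y⟩ :=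
    mkHom _ _ 1 (𝟙 X.base) y 1
      (rel_step (B := B) (DivB := DivB) (γ := δ * Algebra.GrothendieckGroup.of y')
        (δ := δ * Algebra.GrothendieckGroup.of y' * Algebra.GrothendieckGroup.of y) (w := y) rfl)
  let ℓ₂ : (⟨X.base, X.cls * Algebra.GrothendieckGroup.of y⟩ : ModelFrobenioid Φ B DivB) ⟶
      ⟨X.base, δ * Algebra.GrothendieckGroup.of y' * Algebra.GrothendieckGroup.of y⟩ :=
    mkHom _ _ 1 (𝟙 X.base) (div ℓ * y' :) (unit ℓ :) (by
      rw [PNat.one_coe, pow_one, pullGp_id, map_mul]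
      calc X.cls * Algebra.GrothendieckGroup.of y *
            (Algebra.GrothendieckGroup.of (div ℓ) * Algebra.GrothendieckGroup.of y')
          = X.cls * Algebra.GrothendieckGroup.of (div ℓ) *
              (Algebra.GrothendieckGroup.of y' * Algebra.GrothendieckGroup.of y) := by ac_rfl
        _ = δ * divB Φ B DivB (op X.base) (unit ℓ) *
              (Algebra.GrothendieckGroup.of y' * Algebra.GrothendieckGroup.of y) := by rw [hℓ]
        _ = δ * Algebra.GrothendieckGroup.of y' * Algebra.GrothendieckGroup.of y *
              divB Φ B DivB (op X.base) (unit ℓ) := by ac_rfl)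
  have hX := HX s s₀ F₂ rfl rfl rfl rfl rfl rfl rfl rfl rfl rfl
  have hX' := HX' s' s₀' F₂ rfl rfl rfl rfl rfl rfl rfl rfl rfl rfl
  -- (E1') the square `t ∘ s' ∘ ℓ = ℓ₂ ∘ s` read by `κ`
  have e1 : κ t * κ s' * κ ℓ = κ ℓ₂ * κ s := by
    have hsq : (ℓ ≫ s') ≫ t = s ≫ ℓ₂ := by
      refine hom_ext ?_ ?_ ?_ ?_
      · show degFr t * (degFr s' * degFr ℓ) = degFr ℓ₂ * degFr s
        rw [hℓ1]
        rfl
      · show (baseMap ℓ ≫ 𝟙 X.base) ≫ 𝟙 X.base = 𝟙 X.base ≫ 𝟙 X.base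
        rw [hℓb]
        simp only [Category.id_comp]
      · show pull Φ (baseMap ℓ ≫ baseMap s') (div t) * (pull Φ (baseMap ℓ) (div s') * div ℓ ^ (degFr s' : ℕ)) ^
            (degFr t : ℕ) = pull Φ (baseMap s) (div ℓ₂) * div s ^ (degFr ℓ₂ : ℕ)
        rw [hℓb]
        show pull Φ (𝟙 X.base ≫ 𝟙 X.base) y * (pull Φ (𝟙 X.base) y' * div ℓ ^ ((1 : ℕ+) : ℕ)) ^
            ((1 : ℕ+) : ℕ) = pull Φ (𝟙 X.base) (div ℓ * y') * y ^ ((1 : ℕ+) : ℕ)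
        rw [Category.id_comp, pull_id, pull_id, pull_id, PNat.one_coe, pow_one, pow_one, pow_one]
        ac_rfl
      · show pull B (baseMap ℓ ≫ baseMap s') (unit t) * (pull B (baseMap ℓ) (unit s') * unit ℓ ^ (degFr s' : ℕ)) ^
            (degFr t : ℕ) = pull B (baseMap s) (unit ℓ₂) * unit s ^ (degFr ℓ₂ : ℕ)
        rw [hℓb]
        show pull B (𝟙 X.base ≫ 𝟙 X.base) 1 * (pull B (𝟙 X.base) 1 * unit ℓ ^ ((1 : ℕ+) : ℕ)) ^
            ((1 : ℕ+) : ℕ) = pull B (𝟙 X.base) (unit ℓ) * 1 ^ ((1 : ℕ+) : ℕ)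
        rw [map_one, map_one, pull_id, PNat.one_coe, pow_one, pow_one, pow_one, one_mul, one_mul, mul_one]
    have h := congrArg (fun φ => κ φ) hsq
    rw [kappa_comp_of_degFr_eq_one κ hκc (ℓ ≫ s') t rfl, kappa_comp_of_degFr_eq_one κ hκc ℓ s' rfl,
      kappa_comp_of_degFr_eq_one κ hκc s ℓ₂ rfl, baseMap_comp, hℓb] at h
    have h' : pull B (𝟙 X.base ≫ 𝟙 X.base) (κ t :) * (pull B (𝟙 X.base) (κ s' :) * κ ℓ) =
        pull B (𝟙 X.base) (κ ℓ₂ :) * (κ s :) := h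
    rw [Category.id_comp, pull_id, pull_id, pull_id, ← mul_assoc] at h'
    exact h'
  -- (E2') (K2) on the parallel linear arrows `t ∘ s₀'` and `ℓ₂ ∘ s₀` out of `(A, 0)`
  have e2 : κ t * κ s₀' * unit ℓ = κ ℓ₂ * κ s₀ := by
    have h := hκr (s₀' ≫ t) (s₀ ≫ ℓ₂) rfl rfl rfl
    rw [kappa_comp_of_degFr_eq_one κ hκc s₀' t rfl, kappa_comp_of_degFr_eq_one κ hκc s₀ ℓ₂ rfl] at h
    have h' : pull B (𝟙 X.base) (κ t :) * (κ s₀' :) * (pull B (𝟙 X.base) (unit ℓ) * 1 ^ ((1 : ℕ+) : ℕ)) =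
        pull B (𝟙 X.base) (κ ℓ₂ :) * (κ s₀ :) * (pull B (𝟙 X.base) 1 * 1 ^ ((1 : ℕ+) : ℕ)) := h
    rw [pull_id, pull_id, pull_id, map_one, one_pow, mul_one, mul_one, mul_one] at h'
    exact h'
  -- assemble, cancelling the unit `κ s₀' · κ s₀ · κ t`
  rw [hℓb, pull_id, hℓ1, PNat.one_coe, pow_one]
  refine (hB _ (κ s₀' * κ s₀ * κ t)).mul_left_cancel ?_
  calc κ s₀' * κ s₀ * κ t * (κ ℓ * ωX') = κ s₀ * κ t * κ ℓ * (ωX' * κ s₀') := by ac_rfl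
    _ = κ s₀ * κ t * κ ℓ * (κ F₂ * κ s') := by rw [hX']
    _ = κ s₀ * κ F₂ * (κ t * κ s' * κ ℓ) := by ac_rfl
    _ = κ s₀ * κ F₂ * (κ ℓ₂ * κ s) := by rw [e1]
    _ = (κ ℓ₂ * κ s₀) * (κ F₂ * κ s) := by ac_rfl
    _ = (κ t * κ s₀' * unit ℓ) * (ωX * κ s₀) := by rw [e2, hX]
    _ = κ s₀' * κ s₀ * κ t * (unit ℓ * ωX) := by ac_rfl

omit hκr in
/-- **Coboundary identity along a pull-back morphism** `p = (1, b, 0, 1) : X = (A, b^*γ₁) → Y = (A₁, γ₁)`: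
`κ(p) · b^* ω_Y = ω_X`.  From (K1) on the three squares relating `p` to the pull-backs `(1, b, 0, 1)` between
the zero objects and between the targets of the presentations `γ₁ = x₁ − y₁`, `b^*γ₁ = b^*x₁ − b^*y₁`.
[cite: MochizukiFrdI2008, Thm. 5.2(iv) p.102] -/
theorem kappa_pullback {X Y : ModelFrobenioid Φ B DivB} (p : X ⟶ Y) (hp1 : degFr p = 1)
    (hpd : div p = 1) (hpu : unit p = 1) (ωX : B.obj (op X.base)) (ωY : B.obj (op Y.base))
    (HX : ∀ ⦃δ : Algebra.GrothendieckGroup (Φ.obj (op X.base))⦄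
      (s : X ⟶ ⟨X.base, δ⟩) (s₀ : (⟨X.base, 1⟩ : ModelFrobenioid Φ B DivB) ⟶ ⟨X.base, δ⟩)
      (F : (⟨X.base, 1⟩ : ModelFrobenioid Φ B DivB) ⟶ ⟨X.base, 1⟩),
      degFr s = 1 → baseMap s = 𝟙 X.base → unit s = 1 →
      degFr s₀ = 1 → baseMap s₀ = 𝟙 X.base → unit s₀ = 1 →
      degFr F = 2 → baseMap F = 𝟙 X.base → div F = 1 → unit F = 1 → ωX * κ s₀ = κ F * κ s)
    (HY : ∀ ⦃δ : Algebra.GrothendieckGroup (Φ.obj (op Y.base))⦄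
      (s : Y ⟶ ⟨Y.base, δ⟩) (s₀ : (⟨Y.base, 1⟩ : ModelFrobenioid Φ B DivB) ⟶ ⟨Y.base, δ⟩)
      (F : (⟨Y.base, 1⟩ : ModelFrobenioid Φ B DivB) ⟶ ⟨Y.base, 1⟩),
      degFr s = 1 → baseMap s = 𝟙 Y.base → unit s = 1 →
      degFr s₀ = 1 → baseMap s₀ = 𝟙 Y.base → unit s₀ = 1 →
      degFr F = 2 → baseMap F = 𝟙 Y.base → div F = 1 → unit F = 1 → ωY * κ s₀ = κ F * κ s) :
    κ p * pull B (baseMap p) ωY = unit p * ωX ^ (degFr p : ℕ) := by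
  obtain ⟨x₁, y₁, hxy⟩ := exists_cls_eq_div Y
  have hxy' : Y.cls * Algebra.GrothendieckGroup.of y₁ = Algebra.GrothendieckGroup.of x₁ :=
    eq_div_iff_mul_eq'.mp hxy
  -- the class of `X` is the pull-back of that of `Y`
  have hX : X.cls = pullGp Φ (baseMap p) Y.cls := by
    have h := rel p
    rw [hp1, PNat.one_coe, pow_one, hpd, hpu, map_one, mul_one, map_one, mul_one] at h
    exact h
  have hXfrac : X.cls * Algebra.GrothendieckGroup.of (pull Φ (baseMap p) y₁) =
      Algebra.GrothendieckGroup.of (pull Φ (baseMap p) x₁) := by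
    rw [hX]
    show pullGp Φ (baseMap p) Y.cls * Algebra.GrothendieckGroup.of ((Φ.map (baseMap p).op).hom y₁) =
      Algebra.GrothendieckGroup.of ((Φ.map (baseMap p).op).hom x₁)
    rw [← pullGp_of, ← pullGp_of, ← map_mul, hxy']
  -- presentations, zero objects, the three auxiliary pull-backs
  let sY : Y ⟶ ⟨Y.base, Y.cls * Algebra.GrothendieckGroup.of y₁⟩ := mkHom _ _ 1 (𝟙 Y.base) y₁ 1
    (rel_step (B := B) (DivB := DivB) (γ := Y.cls) (δ := Y.cls * Algebra.GrothendieckGroup.of y₁) (w := y₁) rfl)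
  let s₀Y : (⟨Y.base, 1⟩ : ModelFrobenioid Φ B DivB) ⟶ ⟨Y.base, Y.cls * Algebra.GrothendieckGroup.of y₁⟩ :=
    mkHom _ _ 1 (𝟙 Y.base) x₁ 1
      (rel_step (B := B) (DivB := DivB) (γ := 1) (δ := Y.cls * Algebra.GrothendieckGroup.of y₁) (w := x₁)
        (by rw [one_mul]; exact hxy'.symm))
  let sX : X ⟶ ⟨X.base, X.cls * Algebra.GrothendieckGroup.of (pull Φ (baseMap p) y₁)⟩ :=
    mkHom _ _ 1 (𝟙 X.base) (pull Φ (baseMap p) y₁) 1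
      (rel_step (B := B) (DivB := DivB) (γ := X.cls)
        (δ := X.cls * Algebra.GrothendieckGroup.of (pull Φ (baseMap p) y₁)) (w := pull Φ (baseMap p) y₁) rfl)
  let s₀X : (⟨X.base, 1⟩ : ModelFrobenioid Φ B DivB) ⟶
      ⟨X.base, X.cls * Algebra.GrothendieckGroup.of (pull Φ (baseMap p) y₁)⟩ :=
    mkHom _ _ 1 (𝟙 X.base) (pull Φ (baseMap p) x₁) 1
      (rel_step (B := B) (DivB := DivB) (γ := 1)
        (δ := X.cls * Algebra.GrothendieckGroup.of (pull Φ (baseMap p) y₁)) (w := pull Φ (baseMap p) x₁)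
        (by rw [one_mul]; exact hXfrac.symm))
  let FX : (⟨X.base, 1⟩ : ModelFrobenioid Φ B DivB) ⟶ ⟨X.base, 1⟩ :=
    mkHom _ _ 2 (𝟙 X.base) 1 1 (rel_frobZero X.base 2)
  let FY : (⟨Y.base, 1⟩ : ModelFrobenioid Φ B DivB) ⟶ ⟨Y.base, 1⟩ :=
    mkHom _ _ 2 (𝟙 Y.base) 1 1 (rel_frobZero Y.base 2)
  let p₀ : (⟨X.base, 1⟩ : ModelFrobenioid Φ B DivB) ⟶ ⟨Y.base, 1⟩ :=
    mkHom _ _ 1 (baseMap p :) 1 1 (by simp only [PNat.one_coe, pow_one, map_one, mul_one])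
  let pbar : (⟨X.base, X.cls * Algebra.GrothendieckGroup.of (pull Φ (baseMap p) y₁)⟩ : ModelFrobenioid Φ B DivB) ⟶
      ⟨Y.base, Y.cls * Algebra.GrothendieckGroup.of y₁⟩ :=
    mkHom _ _ 1 (baseMap p :) 1 1 (by
      rw [PNat.one_coe, pow_one, map_one, mul_one, map_one, mul_one, map_mul, ← hX, pullGp_of]
      rfl)
  have hXω := HX sX s₀X FX rfl rfl rfl rfl rfl rfl rfl rfl rfl rfl
  have hYω := HY sY s₀Y FY rfl rfl rfl rfl rfl rfl rfl rfl rfl rfl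
  -- (E4) `F_Y ∘ p₀ = p₀ ∘ F_X` read by `κ`, cancelled by `κ p₀`
  have e4 : pull B (baseMap p) (κ FY :) * (κ p₀ :) = (κ FX :) := by
    have hsq : p₀ ≫ FY = FX ≫ p₀ := by
      refine hom_ext rfl ?_ ?_ ?_
      · show baseMap p ≫ 𝟙 Y.base = 𝟙 X.base ≫ baseMap p
        rw [Category.comp_id, Category.id_comp]
      · show pull Φ (baseMap p) 1 * 1 ^ ((2 : ℕ+) : ℕ) = pull Φ (𝟙 X.base) 1 * 1 ^ ((1 : ℕ+) : ℕ)
        rw [map_one, map_one, one_pow, one_pow]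
      · show pull B (baseMap p) 1 * 1 ^ ((2 : ℕ+) : ℕ) = pull B (𝟙 X.base) 1 * 1 ^ ((1 : ℕ+) : ℕ)
        rw [map_one, map_one, one_pow, one_pow]
    have h := congrArg (fun φ => κ φ) hsq
    rw [hκc p₀ FY, kappa_comp_of_degFr_eq_one κ hκc FX p₀ rfl] at h
    have h' : pull B (baseMap p) (κ FY :) * (κ p₀ :) ^ ((2 : ℕ+) : ℕ) =
        pull B (𝟙 X.base) (κ p₀ :) * (κ FX :) := h
    rw [pull_id, show (((2 : ℕ+) : ℕ)) = 2 from rfl] at h'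
    refine (hB _ (κ p₀)).mul_left_cancel ?_
    calc (κ p₀ :) * (pull B (baseMap p) (κ FY :) * (κ p₀ :)) = pull B (baseMap p) (κ FY :) * (κ p₀ :) ^ 2 := by
          rw [pow_two]; ac_rfl
      _ = (κ p₀ :) * (κ FX :) := h'
  -- (E5) `s_Y ∘ p = p̄ ∘ s_X`
  have e5 : pull B (baseMap p) (κ sY :) * κ p = (κ pbar :) * (κ sX :) := by
    have hsq : p ≫ sY = sX ≫ pbar := by
      refine hom_ext ?_ ?_ ?_ ?_
      · show degFr sY * degFr p = degFr pbar * degFr sX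
        rw [hp1]
        rfl
      · show baseMap p ≫ 𝟙 Y.base = 𝟙 X.base ≫ baseMap p
        rw [Category.comp_id, Category.id_comp]
      · show pull Φ (baseMap p) y₁ * div p ^ ((1 : ℕ+) : ℕ) =
          pull Φ (𝟙 X.base) 1 * pull Φ (baseMap p) y₁ ^ ((1 : ℕ+) : ℕ)
        rw [hpd, PNat.one_coe, pow_one, pow_one, map_one, mul_one, one_mul]
      · show pull B (baseMap p) 1 * unit p ^ ((1 : ℕ+) : ℕ) =
          pull B (𝟙 X.base) 1 * 1 ^ ((1 : ℕ+) : ℕ)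
        rw [hpu, map_one, map_one]
    have h := congrArg (fun φ => κ φ) hsq
    rw [kappa_comp_of_degFr_eq_one κ hκc p sY rfl, kappa_comp_of_degFr_eq_one κ hκc sX pbar rfl] at h
    have h' : pull B (baseMap p) (κ sY :) * κ p = pull B (𝟙 X.base) (κ pbar :) * (κ sX :) := h
    rw [pull_id] at h'
    exact h'
  -- (E6) `s₀Y ∘ p₀ = p̄ ∘ s₀X`
  have e6 : pull B (baseMap p) (κ s₀Y :) * (κ p₀ :) = (κ pbar :) * (κ s₀X :) := by
    have hsq : p₀ ≫ s₀Y = s₀X ≫ pbar := by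
      refine hom_ext rfl ?_ ?_ ?_
      · show baseMap p ≫ 𝟙 Y.base = 𝟙 X.base ≫ baseMap p
        rw [Category.comp_id, Category.id_comp]
      · show pull Φ (baseMap p) x₁ * 1 ^ ((1 : ℕ+) : ℕ) =
          pull Φ (𝟙 X.base) 1 * pull Φ (baseMap p) x₁ ^ ((1 : ℕ+) : ℕ)
        rw [PNat.one_coe, pow_one, pow_one, map_one, mul_one, one_mul]
      · show pull B (baseMap p) 1 * 1 ^ ((1 : ℕ+) : ℕ) = pull B (𝟙 X.base) 1 * 1 ^ ((1 : ℕ+) : ℕ)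
        rw [map_one, map_one]
    have h := congrArg (fun φ => κ φ) hsq
    rw [kappa_comp_of_degFr_eq_one κ hκc p₀ s₀Y rfl, kappa_comp_of_degFr_eq_one κ hκc s₀X pbar rfl] at h
    have h' : pull B (baseMap p) (κ s₀Y :) * (κ p₀ :) = pull B (𝟙 X.base) (κ pbar :) * (κ s₀X :) := h
    rw [pull_id] at h'
    exact h'
  -- assemble, cancelling the unit `b^* κ(s₀Y) · κ p₀`
  rw [hpu, one_mul, hp1, PNat.one_coe, pow_one]
  refine (hB _ (pull B (baseMap p) (κ s₀Y :) * (κ p₀ :))).mul_left_cancel ?_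
  calc pull B (baseMap p) (κ s₀Y :) * (κ p₀ :) * (κ p * pull B (baseMap p) ωY)
        = (κ p₀ :) * κ p * (pull B (baseMap p) ωY * pull B (baseMap p) (κ s₀Y :)) := by ac_rfl
    _ = (κ p₀ :) * κ p * (pull B (baseMap p) (κ FY :) * pull B (baseMap p) (κ sY :)) := by
          rw [← map_mul, hYω, map_mul]
    _ = (pull B (baseMap p) (κ FY :) * (κ p₀ :)) * (pull B (baseMap p) (κ sY :) * κ p) := by ac_rfl
    _ = (κ FX :) * ((κ pbar :) * (κ sX :)) := by rw [e4, e5]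
    _ = ((κ FX :) * (κ sX :)) * (κ pbar :) := by ac_rfl
    _ = (ωX * (κ s₀X :)) * (κ pbar :) := by rw [hXω]
    _ = ωX * ((κ pbar :) * (κ s₀X :)) := by ac_rfl
    _ = pull B (baseMap p) (κ s₀Y :) * (κ p₀ :) * ωX := by rw [← e6]; ac_rfl

end Generators

end ModelFrobenioid

end Literature.AlgebraicGeometry.Frobenioids
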